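import Literature.Geometry.Kaehler.ComplexTorusSubtorusHodgeClass
import Literature.AlgebraicGeometry.HodgeTheory.ComplexTorusHodgeClassesComparison
import Literature.AlgebraicGeometry.HodgeTheory.RationallyNormalisedDeRhamFamily
import HarnessLib

/-!
# The cycle class of a complex sub-torus in the model layer: a rational `(p,p)`-class

Layer `Literature/AlgebraicGeometry/HodgeTheory`; lane `lit-hodgefound`, Layer A4, rows A4-18 (c) /
A4-01 (`SKELETON.md` §P p09: "the bridge lemma instantiating A4-01 … `hodgeClassesIn` with this
concrete class map" — TRIBUNAL-A: A4-01 `Motives.BettiCycleData` is MODEL-RELATIVE, its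
CONCRETE-INSTANTIATION is A4-18). The concrete objects: the complex torus `X = E/Φ(ℤ^ι)`
(`ComplexTorus Φ`), a complex sub-torus `Z ⊂ X` of codimension `p` presented by a sub-torus frame
(`ComplexTorus.SubtorusFrame Φ m`, `m + 2p = 2g`, row p08, `ComplexTorusSubtorusCycleClass.lean`), its
cycle class `[Z] = (Φu) ⌟ vol ∈ H^{2p}(X, ℤ) ⊂ Alt^{2p}_ℝ(E; ℂ)` (`SubtorusFrame.cycleClass`, with
`∫_X β ∧ [Z] = ∫_Z β`), which is a HODGE CLASS, `[Z] ∈ H^{2p}(X, ℚ) ∩ H^{p,p}`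
(`SubtorusFrame.cycleClass_mem_hodgeClasses`, row p09, `ComplexTorusSubtorusHodgeClass.lean`; Voisin
(2002), Prop. 11.20; Lange (2023), Lemma 6.2.7). The MODEL carriers of `AlgebraicGeometry/HodgeTheory`:
singular classes `Hᵏ(M; ℂ)` with `IsRationalClass` and the de Rham subspaces
`hodgePQ E M k p q = H^{p,q}(M)`, tied by a natural complex de Rham isomorphism family `e`
(`ComplexDeRhamIsoFamily`), rationally normalised (`IsRationalDeRhamFamily e k`; existence =
`exists_isRational_complexDeRhamIsoFamily_holds`). By `hodgeClasses_comparison` (p248861):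

* `cconstClass_cycleClass_mem_hodgePQ` — the de Rham class of `[Z]` lies in `H^{p,p}(X)` (Voisin
  (2002), Prop. 11.20: "The image in `H^{2r}(X, ℂ)` of the class `[Z] ∈ H^{2r}(X, ℤ)` lies in
  `H^{r,r}(X)`");
* `cycleClass_comparison` — under a rationally normalised family `e`, the singular class `e[Z]` is a
  rational class AND its de Rham class is of type `(p, p)`: `[Z]` is a rational `(p,p)`-class (a Hodge
  class) of the torus in the sense of the model layer;
* `exists_isRationalClass_cycleClass` — with the tree's natural rationally normalised family
  (`exists_isRational_complexDeRhamIsoFamily_holds`), unconditionally: there is a natural `e` under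
  which every sub-torus cycle class is a rational `(p,p)`-class.

No definition, no named fact.

## References

* [VoisinHodgeI2002] C. Voisin, *Hodge Theory and Complex Algebraic Geometry I*, CUP (2002), §11.1.2,
  §11.1.3 Prop. 11.20, §11.3 Thm. 11.31.
* [Lange2023AbelianVarietiesComplex] H. Lange, *Abelian Varieties over the Complex Numbers*, Springer
  (2023), §6.2.1 Lemma 6.2.7, §7.2.2.
-/

noncomputable section

open scoped Manifold ContDiff
open Literature.NumberTheory.Transcendental Literature.Geometry.Kaehler

namespace Literature.AlgebraicGeometry.HodgeTheory

section SubtorusComparison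

variable {ι : Type} [Fintype ι] [DecidableEq ι] {E : Type} [NormedAddCommGroup E] [NormedSpace ℂ E]
  (Φ : (ι → ℝ) ≃L[ℝ] E) {m : ℕ}

/-- **The de Rham class of the cycle class of a complex sub-torus lies in `H^{p,p}(X)`** (Voisin (2002),
Prop. 11.20, for the sub-torus `Z` of a sub-torus frame of `X = E/Φ(ℤ^ι)`, codimension `p`,
`m + 2p = |ι|`): `[constForm [Z]] ∈ hodgePQ E X (2p) p p`. [cite: VoisinHodgeI2002, §11.1.3 Prop. 11.20] -/
theorem cconstClass_cycleClass_mem_hodgePQ (Z : ComplexTorus.SubtorusFrame Φ m) (p : ℕ)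
    (h : m + 2 * p = Fintype.card ι) :
    ComplexTorus.cconstClass Φ (Z.cycleClass p h) ∈ hodgePQ E (ComplexTorus Φ) (2 * p) p p :=
  cconstClass_mem_hodgePQ_of_mem_hodgeClasses Φ (Z.cycleClass_mem_hodgeClasses p h)

/-- **The cycle class of a complex sub-torus is a rational `(p,p)`-class in the model layer**: under a
rationally normalised complex de Rham isomorphism family `e` (degree `2p`), the singular class
`e[Z] ∈ H^{2p}(X; ℂ)` of the sub-torus cycle class is a rational class (`IsRationalClass`) and its de Rham
class lies in `H^{p,p}(X)` — the concrete instantiation, for sub-tori of complex tori, of "the class of an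
analytic cycle is a Hodge class" (Voisin (2002), Thm. 11.31) beneath the model-relative cycle class of
`Motives.BettiCycleData` (row A4-01). [cite: VoisinHodgeI2002, §11.3 Thm. 11.31] -/
theorem cycleClass_comparison (Z : ComplexTorus.SubtorusFrame Φ m) (p : ℕ)
    (h : m + 2 * p = Fintype.card ι) {e : ComplexDeRhamIsoFamily E}
    (he : IsRationalDeRhamFamily e (2 * p)) :
    IsRationalClass (e (ComplexTorus Φ) (2 * p) (ComplexTorus.cconstClass Φ (Z.cycleClass p h))) ∧
      ComplexTorus.cconstClass Φ (Z.cycleClass p h) ∈ hodgePQ E (ComplexTorus Φ) (2 * p) p p :=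
  hodgeClasses_comparison Φ he (Z.cycleClass_mem_hodgeClasses p h)

/-- **Unconditional form**: there is a NATURAL complex de Rham isomorphism family `e` on `E`, rationally
normalised in every degree (the tree's theorem `exists_isRational_complexDeRhamIsoFamily_holds`), under
which the cycle class of every complex sub-torus of `X = E/Φ(ℤ^ι)` (every sub-torus frame, every
codimension `p`) is a rational class with de Rham class in `H^{p,p}(X)`.
[cite: VoisinHodgeI2002, §11.3 Thm. 11.31] -/
theorem exists_isRationalClass_cycleClass [FiniteDimensional ℂ E] :
    ∃ e : ComplexDeRhamIsoFamily E, e.IsNatural ∧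
      ∀ {m : ℕ} (Z : ComplexTorus.SubtorusFrame Φ m) (p : ℕ) (h : m + 2 * p = Fintype.card ι),
        IsRationalClass (e (ComplexTorus Φ) (2 * p) (ComplexTorus.cconstClass Φ (Z.cycleClass p h))) ∧
          ComplexTorus.cconstClass Φ (Z.cycleClass p h) ∈ hodgePQ E (ComplexTorus Φ) (2 * p) p p := by
  obtain ⟨e, hnat, hrat⟩ := exists_isRational_complexDeRhamIsoFamily_holds E
  exact ⟨e, hnat, fun Z p h ↦ cycleClass_comparison Φ Z p h (hrat (2 * p))⟩

end SubtorusComparison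

end Literature.AlgebraicGeometry.HodgeTheory

end
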